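import Summits.AnomalousDissipation.AnomalousDissipation.Theorems.SawtoothPulseCascadeK1LocalisedCascadeKHCombSource

/-!
# K2 lane (route-2 `SawtoothPulseCascade`, crux dir `K1LocalisedCascade`): the single-mode source at ANY mode `ξ` — the two Doppler envelopes

Helper file of the K2 lane (ACL item stmt-AnomalousDissipation-19491; E6/E1 of the S4 line, arbiter A26-13 (3a) / A27-1 (iii) «P2-E6»). Sequel of
`…KHCombSource` (mode `0`): for a general interior mode `e^{2πiξy}` on the line of streamwise wavenumber `a > 0` (any Bloch phase `β`), the six
closed-form terms of the kink-line source (`src_quarter_pieces` / `src_negQuarter_pieces`) have Lorentz denominators `±κ + i(2πξ ± κs)` of modulus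
`κ√(1 + (ξ/a ± s)²)`: the CENTRE piece (Doppler `ξ − as`) carries the envelope `1/√(1+(ξ/a − s)²)` with weight `N₋ = 1 + 2x² + x⁴` and the trough/crest
pieces (Doppler `ξ + as`) the envelope `1/√(1+(ξ/a + s)²)` with weight `N₊ = 1 + 2x + 2x² + 2x³ + x⁴` (`x = e^{−κ/4}`, `q = e^{−κ}`, `κ = 2πa`):
`‖src(±¼, s)‖ ≤ (N₊/√(1+(ξ/a+s)²) + N₋/√(1+(ξ/a−s)²))/((1−q)·2κ·κ)` (`norm_src_quarter_mode_le`, `norm_src_negQuarter_mode_le`). A mode with `ξ/a ∈ [0, θ]`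
un-tilts (resonates) inside the slot; one with `|ξ/a| > θ` never does and its envelope integral is `O(aθ/|ξ|)`. No definitions; no statement about the crux.
[cite: Drazin2002, §8.3 (8.36)–(8.38)] [problem: turb]
-/

-- `Summit.<Summit>.<Problem>`: single-conjunct summit, the duplicate namespace segment is deliberate.
set_option linter.dupNamespace false

noncomputable section

namespace Summit.AnomalousDissipation.AnomalousDissipation.Theorems.SawtoothPulseCascade.K2PhaseBudget

open Set MeasureTheory intervalIntegral Literature.Analysis.FluidPDE.SawtoothCascade

/-! ## §1 Atoms at mode `ξ` -/

/-- The Lorentz denominator at mode `ξ`: `‖±κ + i(2πξ + σκs)‖ = κ√(1+(ξ/a + σs)²)` (`σ = ±1`, `κ = 2πa > 0`). [folklore] -/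
theorem norm_lorentz_denom_mode {a μ ν ν₀ σ ξ : ℝ} (ha : 0 < a) (hμ : μ = 2 * Real.pi * a ∨ μ = -(2 * Real.pi * a))
    (hν : ν = σ * (2 * Real.pi * a)) (hν₀ : ν₀ = 2 * Real.pi * ξ) (s : ℝ) :
    ‖(μ : ℂ) + ((ν₀ + ν * s : ℝ) : ℂ) * Complex.I‖ = (2 * Real.pi * a) * Real.sqrt (1 + (ξ / a + σ * s) ^ 2) := by
  have hκ : 0 < 2 * Real.pi * a := by positivity
  have hμ2 : μ ^ 2 = (2 * Real.pi * a) ^ 2 := by rcases hμ with h | h <;> rw [h]; ring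
  have hin : ν₀ + ν * s = (2 * Real.pi * a) * (ξ / a + σ * s) := by rw [hν₀, hν]; field_simp
  rw [Complex.norm_def, normSq_lorentz_denom, hin, mul_pow, hμ2,
    show (2 * Real.pi * a) ^ 2 + (2 * Real.pi * a) ^ 2 * (ξ / a + σ * s) ^ 2 = (2 * Real.pi * a) ^ 2 * (1 + (ξ / a + σ * s) ^ 2) by ring,
    Real.sqrt_mul' _ (by positivity), Real.sqrt_sq hκ.le]

/-- **One term at mode `ξ`:** `‖(e^{λy₂} − e^{λy₁})/λ‖ ≤ (e^{μy₂} + e^{μy₁})/(κ√(1+(ξ/a + σs)²))`. [folklore] -/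
theorem norm_twoExp_div_mode_le {a μ ν ν₀ σ ξ : ℝ} (ha : 0 < a) (hμ : μ = 2 * Real.pi * a ∨ μ = -(2 * Real.pi * a))
    (hν : ν = σ * (2 * Real.pi * a)) (hν₀ : ν₀ = 2 * Real.pi * ξ) (y₁ y₂ s : ℝ) :
    ‖(Complex.exp (((μ : ℂ) + ((ν₀ + ν * s : ℝ) : ℂ) * Complex.I) * (y₂ : ℂ)) -
        Complex.exp (((μ : ℂ) + ((ν₀ + ν * s : ℝ) : ℂ) * Complex.I) * (y₁ : ℂ))) /
        ((μ : ℂ) + ((ν₀ + ν * s : ℝ) : ℂ) * Complex.I)‖ ≤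
      (Real.exp (μ * y₂) + Real.exp (μ * y₁)) / ((2 * Real.pi * a) * Real.sqrt (1 + (ξ / a + σ * s) ^ 2)) := by
  rw [norm_div, norm_lorentz_denom_mode ha hμ hν hν₀ s]
  apply div_le_div_of_nonneg_right _ (by positivity)
  exact (norm_sub_le _ _).trans (by rw [norm_cexp_lorentz_mul, norm_cexp_lorentz_mul])

/-- **An `A`-type term at mode `ξ`.** [cite: Drazin2002, §8.3 (8.36)–(8.38)] -/
theorem norm_termA_mode_le {a μ ν ν₀ σ ξ : ℝ} (ha : 0 < a) (β : ℝ) {P : ℂ} (hP : ‖P‖ = 1)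
    (hμ : μ = 2 * Real.pi * a ∨ μ = -(2 * Real.pi * a)) (hν : ν = σ * (2 * Real.pi * a)) (hν₀ : ν₀ = 2 * Real.pi * ξ)
    {mc : ℂ} (m y₁ y₂ s : ℝ) (hm : mc = (m : ℂ)) :
    ‖(P * (-1 / ((1 - starRingEnd ℂ (Complex.exp (2 * Real.pi * β * Complex.I)) * (Real.exp (-(2 * Real.pi * a)) : ℂ)) * (2 * (2 * Real.pi * a)))) *
        Complex.exp (-((2 * Real.pi * a : ℝ) : ℂ) * mc)) *
      ((Complex.exp (((μ : ℂ) + ((ν₀ + ν * s : ℝ) : ℂ) * Complex.I) * (y₂ : ℂ)) -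
        Complex.exp (((μ : ℂ) + ((ν₀ + ν * s : ℝ) : ℂ) * Complex.I) * (y₁ : ℂ))) /
        ((μ : ℂ) + ((ν₀ + ν * s : ℝ) : ℂ) * Complex.I))‖ ≤
      Real.exp (-(2 * Real.pi * a) * m) * (Real.exp (μ * y₂) + Real.exp (μ * y₁)) /
        (((1 - Real.exp (-(2 * Real.pi * a))) * (2 * (2 * Real.pi * a))) * ((2 * Real.pi * a) * Real.sqrt (1 + (ξ / a + σ * s) ^ 2))) := by
  subst hm
  have hA := norm_coefA_le ha β
  have hT := norm_twoExp_div_mode_le ha hμ hν hν₀ y₁ y₂ s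
  have hq1 : Real.exp (-(2 * Real.pi * a)) < 1 := Real.exp_lt_one_iff.2 (by nlinarith [Real.pi_pos])
  have hκ : 0 < 2 * (2 * Real.pi * a) := by positivity
  have hden : 0 < (1 - Real.exp (-(2 * Real.pi * a))) * (2 * (2 * Real.pi * a)) := by nlinarith
  have hE : ‖Complex.exp (-((2 * Real.pi * a : ℝ) : ℂ) * (m : ℂ))‖ = Real.exp (-(2 * Real.pi * a) * m) := by
    rw [show -((2 * Real.pi * a : ℝ) : ℂ) * (m : ℂ) = ((-(2 * Real.pi * a) * m : ℝ) : ℂ) by push_cast; ring, ← Complex.ofReal_exp,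
      Complex.norm_real, Real.norm_eq_abs, abs_of_pos (Real.exp_pos _)]
  rw [norm_mul, norm_mul, norm_mul, hP, one_mul, hE]
  calc ‖(-1 / ((1 - starRingEnd ℂ (Complex.exp (2 * Real.pi * β * Complex.I)) * (Real.exp (-(2 * Real.pi * a)) : ℂ)) * (2 * (2 * Real.pi * a))) : ℂ)‖ *
          Real.exp (-(2 * Real.pi * a) * m) *
        ‖(Complex.exp (((μ : ℂ) + ((ν₀ + ν * s : ℝ) : ℂ) * Complex.I) * (y₂ : ℂ)) -
            Complex.exp (((μ : ℂ) + ((ν₀ + ν * s : ℝ) : ℂ) * Complex.I) * (y₁ : ℂ))) /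
            ((μ : ℂ) + ((ν₀ + ν * s : ℝ) : ℂ) * Complex.I)‖
        ≤ 1 / ((1 - Real.exp (-(2 * Real.pi * a))) * (2 * (2 * Real.pi * a))) * Real.exp (-(2 * Real.pi * a) * m) *
          ((Real.exp (μ * y₂) + Real.exp (μ * y₁)) / ((2 * Real.pi * a) * Real.sqrt (1 + (ξ / a + σ * s) ^ 2))) := by
        gcongr
    _ = _ := by field_simp

/-- **A `B`-type term at mode `ξ`.** [cite: Drazin2002, §8.3 (8.36)–(8.38)] -/
theorem norm_termB_mode_le {a μ ν ν₀ σ ξ : ℝ} (ha : 0 < a) (β : ℝ) {P : ℂ} (hP : ‖P‖ = 1)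
    (hμ : μ = 2 * Real.pi * a ∨ μ = -(2 * Real.pi * a)) (hν : ν = σ * (2 * Real.pi * a)) (hν₀ : ν₀ = 2 * Real.pi * ξ)
    {mc : ℂ} (m y₁ y₂ s : ℝ) (hm : mc = (m : ℂ)) :
    ‖(P * (-(Complex.exp (2 * Real.pi * β * Complex.I) * (Real.exp (-(2 * Real.pi * a)) : ℂ)) /
        ((1 - Complex.exp (2 * Real.pi * β * Complex.I) * (Real.exp (-(2 * Real.pi * a)) : ℂ)) * (2 * (2 * Real.pi * a)))) *
        Complex.exp (((2 * Real.pi * a : ℝ) : ℂ) * mc)) *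
      ((Complex.exp (((μ : ℂ) + ((ν₀ + ν * s : ℝ) : ℂ) * Complex.I) * (y₂ : ℂ)) -
        Complex.exp (((μ : ℂ) + ((ν₀ + ν * s : ℝ) : ℂ) * Complex.I) * (y₁ : ℂ))) /
        ((μ : ℂ) + ((ν₀ + ν * s : ℝ) : ℂ) * Complex.I))‖ ≤
      Real.exp (-(2 * Real.pi * a)) * Real.exp ((2 * Real.pi * a) * m) * (Real.exp (μ * y₂) + Real.exp (μ * y₁)) /
        (((1 - Real.exp (-(2 * Real.pi * a))) * (2 * (2 * Real.pi * a))) * ((2 * Real.pi * a) * Real.sqrt (1 + (ξ / a + σ * s) ^ 2))) := by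
  subst hm
  have hB := norm_coefB_le ha β
  have hT := norm_twoExp_div_mode_le ha hμ hν hν₀ y₁ y₂ s
  have hq1 : Real.exp (-(2 * Real.pi * a)) < 1 := Real.exp_lt_one_iff.2 (by nlinarith [Real.pi_pos])
  have hκ : 0 < 2 * (2 * Real.pi * a) := by positivity
  have hden : 0 < (1 - Real.exp (-(2 * Real.pi * a))) * (2 * (2 * Real.pi * a)) := by nlinarith
  have hE : ‖Complex.exp (((2 * Real.pi * a : ℝ) : ℂ) * (m : ℂ))‖ = Real.exp ((2 * Real.pi * a) * m) := by
    rw [show ((2 * Real.pi * a : ℝ) : ℂ) * (m : ℂ) = (((2 * Real.pi * a) * m : ℝ) : ℂ) by push_cast; ring, ← Complex.ofReal_exp,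
      Complex.norm_real, Real.norm_eq_abs, abs_of_pos (Real.exp_pos _)]
  rw [norm_mul, norm_mul, norm_mul, hP, one_mul, hE]
  calc ‖(-(Complex.exp (2 * Real.pi * β * Complex.I) * (Real.exp (-(2 * Real.pi * a)) : ℂ)) /
          ((1 - Complex.exp (2 * Real.pi * β * Complex.I) * (Real.exp (-(2 * Real.pi * a)) : ℂ)) * (2 * (2 * Real.pi * a))) : ℂ)‖ *
          Real.exp ((2 * Real.pi * a) * m) *
        ‖(Complex.exp (((μ : ℂ) + ((ν₀ + ν * s : ℝ) : ℂ) * Complex.I) * (y₂ : ℂ)) -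
            Complex.exp (((μ : ℂ) + ((ν₀ + ν * s : ℝ) : ℂ) * Complex.I) * (y₁ : ℂ))) /
            ((μ : ℂ) + ((ν₀ + ν * s : ℝ) : ℂ) * Complex.I)‖
        ≤ Real.exp (-(2 * Real.pi * a)) / ((1 - Real.exp (-(2 * Real.pi * a))) * (2 * (2 * Real.pi * a))) * Real.exp ((2 * Real.pi * a) * m) *
          ((Real.exp (μ * y₂) + Real.exp (μ * y₁)) / ((2 * Real.pi * a) * Real.sqrt (1 + (ξ / a + σ * s) ^ 2))) := by
        gcongr
    _ = _ := by field_simp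

/-! ## §2 The two-envelope source bounds at mode `ξ` -/

section envelope

variable {a : ℝ} {K G : ℝ → ℂ}

/-- **Source at `y₀ = ¼`, mode `ξ`, pointwise two-envelope bound** (`a > 0`, any `β`, `ξ`, `s`):
`‖∫_{−½}^{½} G(¼−y) e^{2πiξy} e^{−2πiasT(y)} dy‖ ≤ (N₊/√(1+(ξ/a+s)²) + N₋/√(1+(ξ/a−s)²))/((1−q)·2κ·κ)`,
`N₊ = 1 + 2x + 2x² + 2x³ + x⁴` (trough + crest), `N₋ = 1 + 2x² + x⁴` (centre strip), `x = e^{−κ/4}`. [cite: Drazin2002, §8.3 (8.36)–(8.38)] -/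
theorem norm_src_quarter_mode_le (ha : 0 < a) (β ξ s : ℝ)
    (hK : K = fun r : ℝ => (-((Real.exp (-(2 * Real.pi * a * r)) : ℂ) /
            (1 - starRingEnd ℂ (Complex.exp (2 * Real.pi * β * Complex.I)) * (Real.exp (-(2 * Real.pi * a)) : ℂ))
          + (Real.exp (2 * Real.pi * a * (r - 1)) : ℂ) * Complex.exp (2 * Real.pi * β * Complex.I) /
            (1 - Complex.exp (2 * Real.pi * β * Complex.I) * (Real.exp (-(2 * Real.pi * a)) : ℂ))) /
        (2 * (2 * Real.pi * a) : ℂ)))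
    (hG : ∀ u : ℝ, G u = Complex.exp (2 * Real.pi * β * (⌊u⌋ : ℝ) * Complex.I) * K (u - ⌊u⌋)) :
    ‖∫ y in (-(1 / 2 : ℝ))..(1 / 2 : ℝ), G ((1 / 4 : ℝ) - y) * Complex.exp (((2 * Real.pi * ξ * y : ℝ) : ℂ) * Complex.I) *
        Complex.exp (-((2 * Real.pi * a * s * triWave y : ℝ) : ℂ) * Complex.I)‖ ≤
      (1 + 2 * Real.exp (-(2 * Real.pi * a) / 4) + 2 * Real.exp (-(2 * Real.pi * a) / 4) ^ 2 + 2 * Real.exp (-(2 * Real.pi * a) / 4) ^ 3 +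
            Real.exp (-(2 * Real.pi * a) / 4) ^ 4) /
          (((1 - Real.exp (-(2 * Real.pi * a))) * (2 * (2 * Real.pi * a))) * ((2 * Real.pi * a) * Real.sqrt (1 + (ξ / a + 1 * s) ^ 2))) +
        (1 + 2 * Real.exp (-(2 * Real.pi * a) / 4) ^ 2 + Real.exp (-(2 * Real.pi * a) / 4) ^ 4) /
          (((1 - Real.exp (-(2 * Real.pi * a))) * (2 * (2 * Real.pi * a))) * ((2 * Real.pi * a) * Real.sqrt (1 + (ξ / a + (-1) * s) ^ 2))) := by
  rw [src_quarter_pieces ha β ξ hK hG s]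
  refine (norm_six_le (φ₁ := Real.pi * a) (φ₂ := 0) (φ₃ := -(Real.pi * a)) (s := s)
    (norm_termA_mode_le ha β (P := 1) (by simp) (Or.inl rfl) (σ := 1) (by ring) (ν₀ := 2 * Real.pi * ξ) rfl
      (1 / 4) (-(1 / 2)) (-(1 / 4)) s (by simp))
    (norm_termB_mode_le ha β (P := 1) (by simp) (Or.inr rfl) (σ := 1) (by ring) (ν₀ := 2 * Real.pi * ξ) rfl
      (1 / 4) (-(1 / 2)) (-(1 / 4)) s (by simp))
    (norm_termA_mode_le ha β (P := 1) (by simp) (Or.inl rfl) (σ := -1) (by ring) (ν₀ := 2 * Real.pi * ξ) rfl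
      (1 / 4) (-(1 / 4)) (1 / 4) s (by simp))
    (norm_termB_mode_le ha β (P := 1) (by simp) (Or.inr rfl) (σ := -1) (by ring) (ν₀ := 2 * Real.pi * ξ) rfl
      (1 / 4) (-(1 / 4)) (1 / 4) s (by simp))
    (norm_termA_mode_le ha β (norm_pref_conj β) (Or.inl rfl) (σ := 1) (by ring) (ν₀ := 2 * Real.pi * ξ) rfl
      (5 / 4) (1 / 4) (1 / 2) s (by simp))
    (norm_termB_mode_le ha β (norm_pref_conj β) (Or.inr rfl) (σ := 1) (by ring) (ν₀ := 2 * Real.pi * ξ) rfl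
      (5 / 4) (1 / 4) (1 / 2) s (by simp))).trans
    (le_of_eq ?_)
  set x : ℝ := Real.exp (-(2 * Real.pi * a) / 4) with hx
  have hxj : ∀ (t : ℝ) (j : ℕ), t = -(2 * Real.pi * a) / 4 * j → Real.exp t = x ^ j := by
    intro t j ht; rw [ht, hx, ← Real.exp_nat_mul]; ring_nf
  have p1 : Real.exp (-(2 * Real.pi * a) * (1 / 4)) * (Real.exp (2 * Real.pi * a * -(1 / 4)) + Real.exp (2 * Real.pi * a * -(1 / 2))) =
      x ^ 2 + x ^ 3 := by
    rw [mul_add, ← Real.exp_add, ← Real.exp_add, hxj _ 2 (by push_cast; ring), hxj _ 3 (by push_cast; ring)]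
  have p2 : Real.exp (-(2 * Real.pi * a)) * Real.exp (2 * Real.pi * a * (1 / 4)) *
      (Real.exp (-(2 * Real.pi * a) * -(1 / 4)) + Real.exp (-(2 * Real.pi * a) * -(1 / 2))) = x ^ 2 + x := by
    rw [mul_add, ← Real.exp_add, ← Real.exp_add, ← Real.exp_add, hxj _ 2 (by push_cast; ring), hxj _ 1 (by push_cast; ring), pow_one]
  have p3 : Real.exp (-(2 * Real.pi * a) * (1 / 4)) * (Real.exp (2 * Real.pi * a * (1 / 4)) + Real.exp (2 * Real.pi * a * -(1 / 4))) =
      1 + x ^ 2 := by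
    rw [mul_add, ← Real.exp_add, ← Real.exp_add, hxj _ 0 (by push_cast; ring), hxj _ 2 (by push_cast; ring), pow_zero]
  have p4 : Real.exp (-(2 * Real.pi * a)) * Real.exp (2 * Real.pi * a * (1 / 4)) *
      (Real.exp (-(2 * Real.pi * a) * (1 / 4)) + Real.exp (-(2 * Real.pi * a) * -(1 / 4))) = x ^ 4 + x ^ 2 := by
    rw [mul_add, ← Real.exp_add, ← Real.exp_add, ← Real.exp_add, hxj _ 4 (by push_cast; ring), hxj _ 2 (by push_cast; ring)]
  have p5 : Real.exp (-(2 * Real.pi * a) * (5 / 4)) * (Real.exp (2 * Real.pi * a * (1 / 2)) + Real.exp (2 * Real.pi * a * (1 / 4))) =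
      x ^ 3 + x ^ 4 := by
    rw [mul_add, ← Real.exp_add, ← Real.exp_add, hxj _ 3 (by push_cast; ring), hxj _ 4 (by push_cast; ring)]
  have p6 : Real.exp (-(2 * Real.pi * a)) * Real.exp (2 * Real.pi * a * (5 / 4)) *
      (Real.exp (-(2 * Real.pi * a) * (1 / 2)) + Real.exp (-(2 * Real.pi * a) * (1 / 4))) = x + 1 := by
    rw [mul_add, ← Real.exp_add, ← Real.exp_add, ← Real.exp_add, hxj _ 1 (by push_cast; ring), hxj _ 0 (by push_cast; ring), pow_one,
      pow_zero]
  rw [p1, p2, p3, p4, p5, p6]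
  ring

/-- **Source at `y₀ = −¼`, mode `ξ`, pointwise two-envelope bound** (same weights). [cite: Drazin2002, §8.3 (8.36)–(8.38)] -/
theorem norm_src_negQuarter_mode_le (ha : 0 < a) (β ξ s : ℝ)
    (hK : K = fun r : ℝ => (-((Real.exp (-(2 * Real.pi * a * r)) : ℂ) /
            (1 - starRingEnd ℂ (Complex.exp (2 * Real.pi * β * Complex.I)) * (Real.exp (-(2 * Real.pi * a)) : ℂ))
          + (Real.exp (2 * Real.pi * a * (r - 1)) : ℂ) * Complex.exp (2 * Real.pi * β * Complex.I) /
            (1 - Complex.exp (2 * Real.pi * β * Complex.I) * (Real.exp (-(2 * Real.pi * a)) : ℂ))) /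
        (2 * (2 * Real.pi * a) : ℂ)))
    (hG : ∀ u : ℝ, G u = Complex.exp (2 * Real.pi * β * (⌊u⌋ : ℝ) * Complex.I) * K (u - ⌊u⌋)) :
    ‖∫ y in (-(1 / 2 : ℝ))..(1 / 2 : ℝ), G ((-(1 / 4 : ℝ)) - y) * Complex.exp (((2 * Real.pi * ξ * y : ℝ) : ℂ) * Complex.I) *
        Complex.exp (-((2 * Real.pi * a * s * triWave y : ℝ) : ℂ) * Complex.I)‖ ≤
      (1 + 2 * Real.exp (-(2 * Real.pi * a) / 4) + 2 * Real.exp (-(2 * Real.pi * a) / 4) ^ 2 + 2 * Real.exp (-(2 * Real.pi * a) / 4) ^ 3 +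
            Real.exp (-(2 * Real.pi * a) / 4) ^ 4) /
          (((1 - Real.exp (-(2 * Real.pi * a))) * (2 * (2 * Real.pi * a))) * ((2 * Real.pi * a) * Real.sqrt (1 + (ξ / a + 1 * s) ^ 2))) +
        (1 + 2 * Real.exp (-(2 * Real.pi * a) / 4) ^ 2 + Real.exp (-(2 * Real.pi * a) / 4) ^ 4) /
          (((1 - Real.exp (-(2 * Real.pi * a))) * (2 * (2 * Real.pi * a))) * ((2 * Real.pi * a) * Real.sqrt (1 + (ξ / a + (-1) * s) ^ 2))) := by
  rw [src_negQuarter_pieces ha β ξ hK hG s]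
  refine (norm_six_le (φ₁ := Real.pi * a) (φ₂ := 0) (φ₃ := -(Real.pi * a)) (s := s)
    (norm_termA_mode_le ha β (P := 1) (by simp) (Or.inl rfl) (σ := 1) (by ring) (ν₀ := 2 * Real.pi * ξ) rfl
      (-(1 / 4)) (-(1 / 2)) (-(1 / 4)) s (by simp))
    (norm_termB_mode_le ha β (P := 1) (by simp) (Or.inr rfl) (σ := 1) (by ring) (ν₀ := 2 * Real.pi * ξ) rfl
      (-(1 / 4)) (-(1 / 2)) (-(1 / 4)) s (by simp))
    (norm_termA_mode_le ha β (norm_pref_conj β) (Or.inl rfl) (σ := -1) (by ring) (ν₀ := 2 * Real.pi * ξ) rfl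
      (3 / 4) (-(1 / 4)) (1 / 4) s (by simp))
    (norm_termB_mode_le ha β (norm_pref_conj β) (Or.inr rfl) (σ := -1) (by ring) (ν₀ := 2 * Real.pi * ξ) rfl
      (3 / 4) (-(1 / 4)) (1 / 4) s (by simp))
    (norm_termA_mode_le ha β (norm_pref_conj β) (Or.inl rfl) (σ := 1) (by ring) (ν₀ := 2 * Real.pi * ξ) rfl
      (3 / 4) (1 / 4) (1 / 2) s (by simp))
    (norm_termB_mode_le ha β (norm_pref_conj β) (Or.inr rfl) (σ := 1) (by ring) (ν₀ := 2 * Real.pi * ξ) rfl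
      (3 / 4) (1 / 4) (1 / 2) s (by simp))).trans
    (le_of_eq ?_)
  set x : ℝ := Real.exp (-(2 * Real.pi * a) / 4) with hx
  have hxj : ∀ (t : ℝ) (j : ℕ), t = -(2 * Real.pi * a) / 4 * j → Real.exp t = x ^ j := by
    intro t j ht; rw [ht, hx, ← Real.exp_nat_mul]; ring_nf
  have p1 : Real.exp (-(2 * Real.pi * a) * -(1 / 4)) * (Real.exp (2 * Real.pi * a * -(1 / 4)) + Real.exp (2 * Real.pi * a * -(1 / 2))) =
      1 + x := by
    rw [mul_add, ← Real.exp_add, ← Real.exp_add, hxj _ 0 (by push_cast; ring), hxj _ 1 (by push_cast; ring), pow_zero, pow_one]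
  have p2 : Real.exp (-(2 * Real.pi * a)) * Real.exp (2 * Real.pi * a * -(1 / 4)) *
      (Real.exp (-(2 * Real.pi * a) * -(1 / 4)) + Real.exp (-(2 * Real.pi * a) * -(1 / 2))) = x ^ 4 + x ^ 3 := by
    rw [mul_add, ← Real.exp_add, ← Real.exp_add, ← Real.exp_add, hxj _ 4 (by push_cast; ring), hxj _ 3 (by push_cast; ring)]
  have p3 : Real.exp (-(2 * Real.pi * a) * (3 / 4)) * (Real.exp (2 * Real.pi * a * (1 / 4)) + Real.exp (2 * Real.pi * a * -(1 / 4))) =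
      x ^ 2 + x ^ 4 := by
    rw [mul_add, ← Real.exp_add, ← Real.exp_add, hxj _ 2 (by push_cast; ring), hxj _ 4 (by push_cast; ring)]
  have p4 : Real.exp (-(2 * Real.pi * a)) * Real.exp (2 * Real.pi * a * (3 / 4)) *
      (Real.exp (-(2 * Real.pi * a) * (1 / 4)) + Real.exp (-(2 * Real.pi * a) * -(1 / 4))) = x ^ 2 + 1 := by
    rw [mul_add, ← Real.exp_add, ← Real.exp_add, ← Real.exp_add, hxj _ 2 (by push_cast; ring), hxj _ 0 (by push_cast; ring), pow_zero]
  have p5 : Real.exp (-(2 * Real.pi * a) * (3 / 4)) * (Real.exp (2 * Real.pi * a * (1 / 2)) + Real.exp (2 * Real.pi * a * (1 / 4))) =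
      x + x ^ 2 := by
    rw [mul_add, ← Real.exp_add, ← Real.exp_add, hxj _ 1 (by push_cast; ring), hxj _ 2 (by push_cast; ring), pow_one]
  have p6 : Real.exp (-(2 * Real.pi * a)) * Real.exp (2 * Real.pi * a * (3 / 4)) *
      (Real.exp (-(2 * Real.pi * a) * (1 / 2)) + Real.exp (-(2 * Real.pi * a) * (1 / 4))) = x ^ 3 + x ^ 2 := by
    rw [mul_add, ← Real.exp_add, ← Real.exp_add, ← Real.exp_add, hxj _ 3 (by push_cast; ring), hxj _ 2 (by push_cast; ring)]
  rw [p1, p2, p3, p4, p5, p6]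
  ring

end envelope

end Summit.AnomalousDissipation.AnomalousDissipation.Theorems.SawtoothPulseCascade.K2PhaseBudget

end
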